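import Literature.AnabelianGeometry.AbsoluteAnabelian.AbsTopIII.Thm19CuspidalDegree
import HarnessLib

/-!
# [AbsTopIII] Thm. 1.9 (b) for several cusps from its natural single-cusp form (proof-only companion)

Mochizuki, *Topics in Absolute Anabelian Geometry III*, §1, Thm. 1.9 (b) p. 37 (lit key
`paper:url-5493eb38cbb7`): "One constructs the natural isomorphisms `I_z ⥲ μ_Ẑ(Π_U) := M_Z` — where
[...] the points of `Z ∖ U` are all rational over the base field `k_Z` of `Z`, `z ∈ (Z ∖ U)(k_Z)` — via
the technique of Proposition 1.4, (ii)."  abc-iut-L4-t1 typed the several-cusps statement as the named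
fact `CurveModel.Thm_1_9_b` (existence of a `D_z`-equivariant `I_z ≃ M_Z`, `CuspidalSynchronization.lean`,
FROZEN) and the single-cusp NATURAL form `CurveModel.Thm_1_9_b_natural` (THE synchronization of a
cyclotome presentation is bijective; PROVED modulo "`I_x ≅ Ẑ`" in `CcnSynchronizationBijective.lean`),
recording that the former "reduces to it through `U ⊆ Z ∖ {z} ⊆ Z` and Prop. 1.4 (i), a transport
`CurveModel` cannot express without a third curve".  With the third curves supplied as data
(`CurveModel.CuspSyncPresentation`, `Thm19CuspidalDegree.lean`, sub-DAG row Thm19.b of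
`plan/L4/SUBDAG-AbsTopIII-Thm19.md`), THIS FILE proves the reduction:

* `CuspSyncPresentation.syncAt_conj` — THE synchronization at `z` is `D_z`-equivariant (from t1's
  `inertiaSynchronization_conj` at the presentation `Z ∖ {z} ⊆ Z` and `res_comp`);
* `CuspSyncPresentation.syncAt_bijective` — it is bijective whenever `Thm_1_9_b_natural M` holds
  (Prop. 1.4 (i) transport `inertia_bijOn` + the natural form at `(Z ∖ {z} ⊆ Z, z)`);
* `CurveModel.thm_1_9_b_of_presentations` — **`Thm_1_9_b_natural M` + existence of presentations for
  every `U ⊆ Z` as in (b) ⟹ `Thm_1_9_b M`**, the isomorphism being THE natural one.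

All declarations are theorems; no new facts.  HONEST FRAMING: nothing here bears on [IUTchIII] Cor. 3.12.
-/

noncomputable section

open CategoryTheory
open scoped Classical Pointwise

namespace Literature.AnabelianGeometry.AbsoluteAnabelian.AbsTopIII

universe u

namespace CurveModel

namespace CuspSyncPresentation

variable {M : CurveModel.{u}} {U Z : M.Curve} {h : M.IsCofiniteOpen U Z} (P : M.CuspSyncPresentation h)

/-- The transport `I_z ⊆ Δ_U → I_z ⊆ Δ_{U_z}` is the restriction of `Π_U ↠ Π_{U_z}` (values).
[cite: MochizukiAbsTopIII2015, Prop 1.4 (i) p.31] -/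
@[simp] theorem coe_inertiaTransport (z : (M.cusps U).Cusp) (i : (M.cusps U).Icusp z) :
    ((P.inertiaTransport z i : (M.cusps (P.Uz z)).Icusp (P.cusp z)) : (M.ext (P.Uz z)).arith) =
      (M.res (P.hU z)).arith i :=
  rfl

/-- The transport `I_z ⊆ Δ_U → I_z ⊆ Δ_{U_z}` is bijective (Prop. 1.4 (i), field `inertia_bijOn`).
[cite: MochizukiAbsTopIII2015, Prop 1.4 (i) p.31] -/
theorem inertiaTransport_bijective (z : (M.cusps U).Cusp) : Function.Bijective (P.inertiaTransport z) := by
  refine ⟨fun i j hij => ?_, fun j => ?_⟩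
  · exact Subtype.ext ((P.inertia_bijOn z).injOn i.2 j.2 (congrArg Subtype.val hij))
  · obtain ⟨i, hi, hij⟩ := (P.inertia_bijOn z).surjOn j.2
    exact ⟨⟨i, hi⟩, Subtype.ext hij⟩

/-- `Π_U → Π_{U_z} → Π_Z` is `Π_U → Π_Z` on elements (field `res_comp`).
[cite: MochizukiAbsTopIII2015, Thm 1.9 (b) p.37] -/
theorem res_arith_comp_apply (z : (M.cusps U).Cusp) (d : (M.ext U).arith) :
    (M.res (P.hZ z)).arith ((M.res (P.hU z)).arith d) = (M.res h).arith d := by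
  have := congrArg (fun k : M.ext U ⟶ M.ext Z => k.arith d) (P.res_comp z)
  simpa using this

/-- Formula: THE synchronization at `z` is t1's `inertiaSynchronization` of `(U_z ⊆ Z, z)` after
transport. [cite: MochizukiAbsTopIII2015, Thm 1.9 (b) p.37] -/
theorem syncAt_apply (z : (M.cusps U).Cusp) (i : (M.cusps U).Icusp z) :
    P.syncAt z (Additive.ofMul i) =
      inertiaSynchronization (M.res (P.hZ z)) (P.pres z).isCuspidallyCentral.le_cuspidalKernel (P.sec z)
        (P.bij z) (Additive.ofMul (P.inertiaTransport z i)) :=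
  rfl

/-- **`D_z`-equivariance of THE synchronization at `z`**: `sync_z(d i d⁻¹) = d · sync_z(i)` for `d ∈ D_z`,
`i ∈ I_z`, with `Π_U` acting on `M_Z = Hom(H²(Δ_Z, Ẑ), Ẑ)` through `Π_U → Π_Z` (PROVED from
abc-iut-L4-t1's `inertiaSynchronization_conj`). [cite: MochizukiAbsTopIII2015, Thm 1.9 (b) p.37] -/
theorem syncAt_conj (z : (M.cusps U).Cusp) {d : (M.ext U).arith} (hd : d ∈ (M.cusps U).Dcusp z)
    (i : (M.cusps U).Icusp z) :
    P.syncAt z (Additive.ofMul ⟨d * i * d⁻¹, (M.cusps U).conj_mem_Icusp z hd i.2⟩) =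
      geomCyclotomeDualMap (M.ext Z) ZHatCoeff.{u} ((M.res h).arith d) (P.syncAt z (Additive.ofMul i)) := by
  have hgi : (M.res (P.hU z)).arith d * (P.inertiaTransport z i : (M.ext (P.Uz z)).arith) *
      ((M.res (P.hU z)).arith d)⁻¹ ∈ (M.cusps (P.Uz z)).Icusp (P.cusp z) := by
    have hmem := (P.inertiaTransport z ⟨d * i * d⁻¹, (M.cusps U).conj_mem_Icusp z hd i.2⟩).2
    simpa [map_mul, map_inv] using hmem
  have htr : P.inertiaTransport z ⟨d * i * d⁻¹, (M.cusps U).conj_mem_Icusp z hd i.2⟩ =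
      ⟨(M.res (P.hU z)).arith d * (P.inertiaTransport z i : (M.ext (P.Uz z)).arith) *
        ((M.res (P.hU z)).arith d)⁻¹, hgi⟩ := by
    apply Subtype.ext
    simp [map_mul, map_inv]
  rw [syncAt_apply, syncAt_apply, htr,
    inertiaSynchronization_conj (P.pres z).isCuspidallyCentral.le_cuspidalKernel (P.sec z) (P.bij z)
      ((M.res (P.hU z)).arith d) (P.inertiaTransport z i) hgi,
    res_arith_comp_apply]

/-- **THE synchronization at `z` is bijective** when the natural single-cusp form holds for the model
(`Thm_1_9_b_natural`): transport (Prop. 1.4 (i)) followed by the natural synchronization of the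
presentation `(Z ∖ {z} ⊆ Z, z)`. [cite: MochizukiAbsTopIII2015, Thm 1.9 (b) p.37] -/
theorem syncAt_bijective (h9 : M.Thm_1_9_b_natural) (z : (M.cusps U).Cusp) :
    Function.Bijective (P.syncAt z) := by
  have h1 := h9 (P.Uz z) Z (P.hZ z) (P.cusp z) (P.pres z) (P.sec z) (P.bij z)
  have h2 : Function.Bijective (MonoidHom.toAdditive (P.inertiaTransport z)) := by
    refine ⟨fun a b hab => ?_, fun b => ?_⟩
    · exact Additive.toMul.injective ((P.inertiaTransport_bijective z).1 (Additive.ofMul.injective hab))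
    · obtain ⟨a, ha⟩ := (P.inertiaTransport_bijective z).2 (Additive.toMul b)
      exact ⟨Additive.ofMul a, by simpa using congrArg Additive.ofMul ha⟩
  exact h1.comp h2

end CuspSyncPresentation

/-- **Thm. 1.9 (b) for several rational cusps from its natural single-cusp form**: if
`Thm_1_9_b_natural M` holds (THE synchronization of every cyclotome presentation is bijective — PROVED
modulo "`I_x ≅ Ẑ`" by abc-iut-L4-t1, `thm_1_9_b_natural_of_inertiaEquiv`) and every cofinite open
`U ⊆ Z` as in (b) (scheme-like, `Z` proper of genus `≥ 2`, all cusps rational) admits a system of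
cyclotome presentations `U ⊆ Z ∖ {z} ⊆ Z` (`CuspSyncPresentation`, the "third curves"), then the named
fact `Thm_1_9_b M` holds, the isomorphism `I_z ≃ M_Z` being THE natural synchronization `syncAt z`
(`D_z`-equivariant by `syncAt_conj`). [cite: MochizukiAbsTopIII2015, Thm 1.9 (b) p.37] -/
theorem thm_1_9_b_of_presentations (M : CurveModel.{u}) (h9 : M.Thm_1_9_b_natural)
    (hP : ∀ (U Z : M.Curve) (h : M.IsCofiniteOpen U Z), M.IsScheme U → M.IsScheme Z → M.IsProper Z →
      2 ≤ M.genus Z → (∀ c : (M.cusps U).Cusp, (M.cusps U).IsRational c) →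
        Nonempty (M.CuspSyncPresentation h)) :
    M.Thm_1_9_b := by
  intro U Z h hU hZ hZp hg hrat z _
  obtain ⟨P⟩ := hP U Z h hU hZ hZp hg hrat
  refine ⟨AddEquiv.ofBijective (P.syncAt z) (P.syncAt_bijective h9 z), fun d hd i => ?_⟩
  exact P.syncAt_conj z hd i

end CurveModel

end Literature.AnabelianGeometry.AbsoluteAnabelian.AbsTopIII
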